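import Literature.NumberTheory.EllipticCurves.TwoIsogenySelmerGroupSha
import Literature.NumberTheory.EllipticCurves.SelmerCorankHolds
import HarnessLib

/-!
# `cassels_selmerCorank_two_parity` reduced to the parity of `Ш`
# (Dokchitser–Dokchitser, Thm. 30 / Cor. 33; Silverman, *AEC*, X.4.2(a), X.4.14)

A short sibling of `TwoIsogenySelmerGroupSha.lean`. With the unconditional count proved there,

  `2^{s(a,b) + s'(a,b)} = 2^{rank E(ℚ) + 2} · #Ш(V₀/ℚ)[Ξ] · #Ш(E/ℚ)[Ξ]`   (`two_pow_twoIsogenySelmerRank_add_eq`),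

and the corank identity `s₂(E) = rank E(ℚ) + corank_{ℤ₂} Ш(E/ℚ)[2^∞]`
(`selmerCorank_eq_mordellWeilRank_add_holds`), the named fact `cassels_selmerCorank_two_parity` of
`TwoIsogenySelmerGroup.lean` — `s(a,b) + s'(a,b) ≡ s₂(E_{a,b}) (mod 2)`, the parity form of Cassels'
formula used by Dokchitser–Dokchitser (Thm. 30, Cor. 33) — is shown *equivalent* to the statement about
the Tate–Shafarevich groups alone

  `corank_{ℤ₂} Ш(E/ℚ)[2^∞] ≡ dim₂ (#Ш(V₀/ℚ)[Ξ] · #Ш(E/ℚ)[Ξ]) (mod 2)`,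

i.e. `dim Ш(E)[φ] + dim Ш(E')[φ̂] ≡ corank Ш(E)[2^∞] (mod 2)` (`V₀ ≅ E'`, `Ш[Ξ] = Ш ∩ im Ξ = Ш[φ]`). This
is precisely the input supplied in the printed proofs by the Cassels–Tate pairing (alternating on
`Ш/div`, *AEC* X.4.14 = the tree's unproved fact `WeierstrassCurve.exists_casselsTate_pairing`, together
with its adjointness `⟨φ x, y⟩_{E'} = ⟨x, φ̂ y⟩_E`, Milne *ADT* I.6.10), so the theorem records exactly
what remains to discharge the fact.

* `eq_two_pow_sub_of_two_pow_eq_mul` — `2^m = 2^n · N ⇒ N = 2^{m-n}`.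
* `cassels_selmerCorank_two_parity_iff_sha_parity` — the equivalence.

## References

* T. Dokchitser, V. Dokchitser, Root numbers and parity of ranks of elliptic curves, J. reine angew.
  Math. 658 (2011), 39–64, Thm. 30 and Cor. 33. [DokchitserDokchitser2011Crelle]
* J. H. Silverman, *The Arithmetic of Elliptic Curves*, 2nd ed. (2009), Thm. X.4.2(a), Thm. X.4.14.
  [SilvermanAEC2009]
-/

namespace Literature.NumberTheory.EllipticCurves

open _root_.WeierstrassCurve

section ParityReduction

/-- Powers of two: `2^m = 2^n · N` forces `n ≤ m` and `N = 2^(m - n)`. [folklore] -/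
theorem eq_two_pow_sub_of_two_pow_eq_mul {m n N : ℕ} (h : 2 ^ m = 2 ^ n * N) : n ≤ m ∧ N = 2 ^ (m - n) := by
  have hle : n ≤ m := (Nat.pow_dvd_pow_iff_le_right one_lt_two).mp ⟨N, h⟩
  refine ⟨hle, ?_⟩
  have h2 : 2 ^ m = 2 ^ n * 2 ^ (m - n) := by rw [← pow_add, Nat.add_sub_cancel' hle]
  rw [h2] at h
  exact (Nat.eq_of_mul_eq_mul_left (by positivity) h).symm

/-- **What `cassels_selmerCorank_two_parity` comes down to.** Granted the unconditional results of this
file (`2^{s+s'} = 2^{r+2} · #Ш(V₀/ℚ)[Ξ] · #Ш(E/ℚ)[Ξ]`, `two_pow_twoIsogenySelmerRank_add_eq`) and the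
corank identity `s₂(E) = r + corank Ш(E/ℚ)[2^∞]` (`selmerCorank_eq_mordellWeilRank_add_holds`), the
named fact `cassels_selmerCorank_two_parity` (Dokchitser–Dokchitser, Thm. 30 / Cor. 33 in parity form:
`s(a,b) + s'(a,b) ≡ s₂(E_{a,b}) (mod 2)`) is *equivalent* to the parity statement about `Ш` alone:

  `corank_{ℤ₂} Ш(E/ℚ)[2^∞] ≡ dim₂ (#Ш(V₀/ℚ)[Ξ] · #Ш(E/ℚ)[Ξ]) (mod 2)`   (`V₀ ≅ E'`, `Ш[Ξ] = Ш ∩ im Ξ`),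

i.e. `dim Ш(E)[φ] + dim Ш(E')[φ̂] ≡ corank Ш(E)[2^∞]`, which is where the Cassels–Tate pairing (its
alternation on `Ш/div` and its adjointness for `φ`, `φ̂`) enters the printed proofs.
[cite: DokchitserDokchitser2011Crelle, Thm. 30 and Cor. 33] [cite: SilvermanAEC2009, Thm. X.4.2(a) and Thm. X.4.14] -/
theorem cassels_selmerCorank_two_parity_iff_sha_parity :
    cassels_selmerCorank_two_parity ↔
      ∀ a b : ℤ, (hab : b * (a ^ 2 - 4 * b) ≠ 0) →
        haveI := isElliptic_halfModel hab
        haveI := isElliptic_mk_of_ne_zero (F := ℚ) hab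
        (-1 : ℤ) ^ (⟨0, (a : ℚ), 0, (b : ℚ), 0⟩ : WeierstrassCurve ℚ).shaCorank 2 =
          (-1 : ℤ) ^ Nat.log 2
            (Nat.card ↥((⟨0, -(a : ℚ) / 2, 0, ((a : ℚ) ^ 2 - 4 * b) / 16, 0⟩ : WeierstrassCurve ℚ).sha ⊓
                (⟨0, -(a : ℚ) / 2, 0, ((a : ℚ) ^ 2 - 4 * b) / 16, 0⟩ : WeierstrassCurve ℚ).twoIsogenyTorsorHom.range) *
              Nat.card ↥((⟨0, (a : ℚ), 0, (b : ℚ), 0⟩ : WeierstrassCurve ℚ).sha ⊓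
                (⟨0, (a : ℚ), 0, (b : ℚ), 0⟩ : WeierstrassCurve ℚ).twoIsogenyTorsorHom.range)) := by
  haveI : Fact (Nat.Prime 2) := ⟨Nat.prime_two⟩
  -- the reduction for one pair `(a, b)`
  have key : ∀ a b : ℤ, (hab : b * (a ^ 2 - 4 * b) ≠ 0) →
      haveI := isElliptic_halfModel hab
      haveI := isElliptic_mk_of_ne_zero (F := ℚ) hab
      ((-1 : ℤ) ^ (⟨0, (a : ℚ), 0, (b : ℚ), 0⟩ : WeierstrassCurve ℚ).selmerCorank 2 =
          (-1 : ℤ) ^ (twoIsogenySelmerRank a b + twoIsogenySelmerRank' a b) ↔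
        (-1 : ℤ) ^ (⟨0, (a : ℚ), 0, (b : ℚ), 0⟩ : WeierstrassCurve ℚ).shaCorank 2 =
          (-1 : ℤ) ^ Nat.log 2
            (Nat.card ↥((⟨0, -(a : ℚ) / 2, 0, ((a : ℚ) ^ 2 - 4 * b) / 16, 0⟩ : WeierstrassCurve ℚ).sha ⊓
                (⟨0, -(a : ℚ) / 2, 0, ((a : ℚ) ^ 2 - 4 * b) / 16, 0⟩ : WeierstrassCurve ℚ).twoIsogenyTorsorHom.range) *
              Nat.card ↥((⟨0, (a : ℚ), 0, (b : ℚ), 0⟩ : WeierstrassCurve ℚ).sha ⊓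
                (⟨0, (a : ℚ), 0, (b : ℚ), 0⟩ : WeierstrassCurve ℚ).twoIsogenyTorsorHom.range))) := by
    intro a b hab
    haveI := isElliptic_halfModel hab
    haveI := isElliptic_mk_of_ne_zero (F := ℚ) hab
    have hs : (⟨0, (a : ℚ), 0, (b : ℚ), 0⟩ : WeierstrassCurve ℚ).selmerCorank 2 =
        (⟨0, (a : ℚ), 0, (b : ℚ), 0⟩ : WeierstrassCurve ℚ).mordellWeilRank +
          (⟨0, (a : ℚ), 0, (b : ℚ), 0⟩ : WeierstrassCurve ℚ).shaCorank 2 :=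
      (⟨0, (a : ℚ), 0, (b : ℚ), 0⟩ : WeierstrassCurve ℚ).selmerCorank_eq_mordellWeilRank_add_holds 2
    have hprod := two_pow_twoIsogenySelmerRank_add_eq hab
    obtain ⟨hle, hN⟩ := eq_two_pow_sub_of_two_pow_eq_mul hprod
    set N := Nat.card ↥((⟨0, -(a : ℚ) / 2, 0, ((a : ℚ) ^ 2 - 4 * b) / 16, 0⟩ : WeierstrassCurve ℚ).sha ⊓
        (⟨0, -(a : ℚ) / 2, 0, ((a : ℚ) ^ 2 - 4 * b) / 16, 0⟩ : WeierstrassCurve ℚ).twoIsogenyTorsorHom.range) *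
      Nat.card ↥((⟨0, (a : ℚ), 0, (b : ℚ), 0⟩ : WeierstrassCurve ℚ).sha ⊓
        (⟨0, (a : ℚ), 0, (b : ℚ), 0⟩ : WeierstrassCurve ℚ).twoIsogenyTorsorHom.range) with hNdef
    have hk : twoIsogenySelmerRank a b + twoIsogenySelmerRank' a b =
        (⟨0, (a : ℚ), 0, (b : ℚ), 0⟩ : WeierstrassCurve ℚ).mordellWeilRank + 2 + Nat.log 2 N := by
      rw [hN, Nat.log_pow one_lt_two]; omega
    have h2 : ((-1 : ℤ) ^ 2) = 1 := by norm_num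
    rw [hs, hk, pow_add, pow_add, pow_add, h2, mul_one]
    constructor
    · intro h
      exact mul_left_cancel₀ (pow_ne_zero _ (by norm_num)) h
    · intro h; rw [h]
  constructor
  · intro h a b hab
    exact (key a b hab).mp (h a b hab)
  · intro h a b hab
    exact (key a b hab).mpr (h a b hab)

end ParityReduction

end Literature.NumberTheory.EllipticCurves
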